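import Summits.Ventures.Crystal3D.Theorems.StickyWulffConstantGenericWallFloorHStarTransport
import Summits.Ventures.Crystal3D.Theorems.StickyWulffConstantGenericWallFloorSlotDozens
import Summits.Ventures.Crystal3D.Theorems.StickyWulffConstantNoReconstructionGainFccShell
import Summits.Ventures.Crystal3D.Theorems.StickyWulffConstantCoaxialWallLawBarlowWindowFrames
import Literature.Algebra.EuclideanLattices.FccBccLattices
import HarnessLib

/-!
# The equatorial closed star lies in ONE close-packed dozen: `SingleDozen 0 hcpSlots (hStar u₀)` — so E1h is an `ExactOnly` row alone
# (crux `GenericWallFloor`, stmt-Ventures-19480, kernel G; line «LAYER ROWS» of cf-p1 (ccix)/(ccx), the «hand lemma» of R1; 19480-p2 g13)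

HONEST FRAMING. Venture `Summits/Ventures/Crystal3D` (cell `crystal3d-full`), route `route-Ventures-StickyWulffConstant`, helper for the crux
`GenericWallFloor` (stmt-Ventures-19480) / consumer `TextureLiminfV5` (stmt-Ventures-23912).  Lattice algebra on the landed dozen-rigidity lemmas
(`fccDozen_eq_slots_of_three_independent`, `hcpDozen_twin_of_three_independent`); standard axioms; no certificate; F-C1 not moved.

THE POINT.  `HStarModel` (…HStarTransport) asks, for each in-plane slot `u₀`, `ExactOnly 0 (hStar u₀)` (E1h, certified computation A12-583) AND
`SingleDozen 0 hcpSlots (hStar u₀)`.  The second conjunct is a THEOREM (owner's enumeration LAYER-ROWS-R1-CHECK.md §1, row 2): a close-packed dozen `D`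
around `0` containing the equatorial closed star `{b, b ± 60°, t, M t}` (`b = −u₀`, `t` the upper slot adjacent to `b`, `M` the basal mirror)
* contains the three independent slots `b, a, t` (`a` the hexagon neighbour of `b` on `t`'s side: `exists_triangle_of_inPlane`), so it is the slot
  dozen `fccSlots` if cuboctahedral (`fccDozen_eq_slots_of_three_independent`) — impossible, `M t` is no slot (`⟪t, M t⟫ = −1/3`,
  `basalMirror_not_mem_fccSlots`) — or a TWIN DOZEN across some `{111}` normal `n` if anticuboctahedral (`hcpDozen_twin_of_three_independent`);
* then `M t ∈ D` is the mirror image `w − 2⟪w, n⟫ n` of a negative slot `w` with `⟪w, M t⟫ = −1/3`, which forces `w = t` (`eq_of_inner_basalMirror_eq`)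
  and `n = −e₃`: the twin dozen across the BASAL plane keeping the upper side — `hcpSlots` itself.
* **`singleDozen_hStar`**, **`hStarModel_of_exactOnly : (∀ in-plane u₀, ExactOnly 0 (hStar u₀)) → HStarModel`**.
WHAT THIS IS NOT: no `ExactOnly` certificate (E1h stays named); not the six → one symmetry reduction; F-C1 not moved.
-/

noncomputable section

namespace Summit.Ventures.Crystal3D.Theorems

open Finset
open Literature.MathematicalPhysics.StatisticalMechanics (barlowPos constHagg barlowPos_apply_two basalMirror basalMirror_apply_coord)
open Literature.Geometry.DiscreteGeometry (fccKissingPattern hcpKissingPattern)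
open scoped InnerProductSpace

/-! ### Coordinate tools -/

/-- `⟪M w, t⟫ = ⟪w, t⟫ − 2 w₂ t₂` for the basal mirror `M`. -/
private theorem hStar_inner_mirror_left (w t : EuclideanSpace ℝ (Fin 3)) : ⟪basalMirror w, t⟫_ℝ = ⟪w, t⟫_ℝ - 2 * w 2 * t 2 := by
  rw [Literature.Algebra.EuclideanLattices.inner_fin_three, Literature.Algebra.EuclideanLattices.inner_fin_three, basalMirror_apply_coord, basalMirror_apply_coord, basalMirror_apply_coord]
  simp; ring

/-- `⟪w, M t⟫ = ⟪w, t⟫ − 2 w₂ t₂`. -/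
private theorem hStar_inner_mirror_right (w t : EuclideanSpace ℝ (Fin 3)) : ⟪w, basalMirror t⟫_ℝ = ⟪w, t⟫_ℝ - 2 * w 2 * t 2 := by
  rw [real_inner_comm, hStar_inner_mirror_left, real_inner_comm]; ring

/-- The basal mirror as a vector identity: `M w = w − (2 w₂) • e₃`. -/
theorem basalMirror_eq_sub_smul (w : EuclideanSpace ℝ (Fin 3)) :
    basalMirror w = w - (2 * w 2) • EuclideanSpace.single (2 : Fin 3) (1 : ℝ) := by
  ext t
  rw [basalMirror_apply_coord]
  fin_cases t <;> simp
  ring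

/-- Unit vectors whose difference is a slot make the angle `60°`: `⟪x, y⟫ = ½`. -/
theorem inner_eq_half_of_sub_mem_fccSlots {x y : EuclideanSpace ℝ (Fin 3)} (hx : ‖x‖ = 1) (hy : ‖y‖ = 1) (h : x - y ∈ fccSlots) :
    ⟪x, y⟫_ℝ = 1 / 2 := by
  have h1 := norm_sub_sq_real x y
  rw [norm_eq_one_of_mem_fccSlots h, hx, hy] at h1
  linarith

/-- `⟪x, y⟫ = ½` for two tabulated slots whose coordinate difference is tabulated. -/
theorem inner_barlowPos_eq_half {k i j k' i' j' : ℤ} (hc : (k, i, j) ∈ fccSlotTriples) (hc' : (k', i', j') ∈ fccSlotTriples)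
    (hd : (k - k', i - i', j - j') ∈ fccSlotTriples) :
    ⟪barlowPos 1 (Real.sqrt (2 / 3)) constHagg k i j, barlowPos 1 (Real.sqrt (2 / 3)) constHagg k' i' j'⟫_ℝ = 1 / 2 := by
  refine inner_eq_half_of_sub_mem_fccSlots (norm_eq_one_of_mem_fccSlots (barlowPos_mem_fccSlots hc))
    (norm_eq_one_of_mem_fccSlots (barlowPos_mem_fccSlots hc')) ?_
  rw [barlowPos_fcc_sub]
  exact barlowPos_mem_fccSlots hd

/-! ### The triangle over an in-plane slot -/

/-- **Every in-plane slot `b` spans a TRIANGLE with an upper slot `t` and an in-plane slot `a`**: `⟪b, t⟫ = ⟪b, a⟫ = ⟪a, t⟫ = ½` (a triangular face of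
the cuboctahedron with one upper vertex). -/
theorem exists_triangle_of_inPlane {b : EuclideanSpace ℝ (Fin 3)} (hb : b ∈ fccSlots) (hb2 : b 2 = 0) :
    ∃ t a : EuclideanSpace ℝ (Fin 3), t ∈ fccSlots ∧ t 2 = Real.sqrt (2 / 3) ∧ a ∈ fccSlots ∧ a 2 = 0 ∧
      ⟪b, t⟫_ℝ = 1 / 2 ∧ ⟪b, a⟫_ℝ = 1 / 2 ∧ ⟪a, t⟫_ℝ = 1 / 2 := by
  classical
  have hs : Real.sqrt (2 / 3) ≠ 0 := (Real.sqrt_pos.2 (by norm_num)).ne'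
  have hb' := hb
  rw [fccSlots, mem_image] at hb'
  obtain ⟨c, hc, rfl⟩ := hb'
  rw [barlowPos_apply_two] at hb2
  simp only [fccSlotTriples, mem_insert, mem_singleton] at hc
  -- the twelve table entries; the six out-of-plane ones contradict `b₂ = 0`
  rcases hc with rfl | rfl | rfl | rfl | rfl | rfl | rfl | rfl | rfl | rfl | rfl | rfl <;>
    simp only [Int.cast_one, Int.cast_zero, Int.cast_neg, one_mul, zero_mul, neg_mul, neg_eq_zero] at hb2 <;>
    first
    | exact absurd hb2 hs
    | skip
  -- (0,1,0): t = (1,0,0), a = (0,0,1)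
  · exact ⟨barlowPos 1 (Real.sqrt (2 / 3)) constHagg 1 0 0, barlowPos 1 (Real.sqrt (2 / 3)) constHagg 0 0 1,
      barlowPos_mem_fccSlots (by simp [fccSlotTriples] : ((1:ℤ), (0:ℤ), (0:ℤ)) ∈ fccSlotTriples), by rw [barlowPos_apply_two]; simp,
      barlowPos_mem_fccSlots (by simp [fccSlotTriples] : ((0:ℤ), (0:ℤ), (1:ℤ)) ∈ fccSlotTriples), by rw [barlowPos_apply_two]; simp,
      inner_barlowPos_eq_half (by simp [fccSlotTriples]) (by simp [fccSlotTriples]) (by simp [fccSlotTriples]),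
      inner_barlowPos_eq_half (by simp [fccSlotTriples]) (by simp [fccSlotTriples]) (by simp [fccSlotTriples]),
      inner_barlowPos_eq_half (by simp [fccSlotTriples]) (by simp [fccSlotTriples]) (by simp [fccSlotTriples])⟩
  -- (0,0,1): t = (1,0,0), a = (0,1,0)
  · exact ⟨barlowPos 1 (Real.sqrt (2 / 3)) constHagg 1 0 0, barlowPos 1 (Real.sqrt (2 / 3)) constHagg 0 1 0,
      barlowPos_mem_fccSlots (by simp [fccSlotTriples] : ((1:ℤ), (0:ℤ), (0:ℤ)) ∈ fccSlotTriples), by rw [barlowPos_apply_two]; simp,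
      barlowPos_mem_fccSlots (by simp [fccSlotTriples] : ((0:ℤ), (1:ℤ), (0:ℤ)) ∈ fccSlotTriples), by rw [barlowPos_apply_two]; simp,
      inner_barlowPos_eq_half (by simp [fccSlotTriples]) (by simp [fccSlotTriples]) (by simp [fccSlotTriples]),
      inner_barlowPos_eq_half (by simp [fccSlotTriples]) (by simp [fccSlotTriples]) (by simp [fccSlotTriples]),
      inner_barlowPos_eq_half (by simp [fccSlotTriples]) (by simp [fccSlotTriples]) (by simp [fccSlotTriples])⟩
  -- (0,1,-1): t = (1,0,-1), a = (0,0,-1)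
  · exact ⟨barlowPos 1 (Real.sqrt (2 / 3)) constHagg 1 0 (-1), barlowPos 1 (Real.sqrt (2 / 3)) constHagg 0 0 (-1),
      barlowPos_mem_fccSlots (by simp [fccSlotTriples] : ((1:ℤ), (0:ℤ), (-1:ℤ)) ∈ fccSlotTriples), by rw [barlowPos_apply_two]; simp,
      barlowPos_mem_fccSlots (by simp [fccSlotTriples] : ((0:ℤ), (0:ℤ), (-1:ℤ)) ∈ fccSlotTriples), by rw [barlowPos_apply_two]; simp,
      inner_barlowPos_eq_half (by simp [fccSlotTriples]) (by simp [fccSlotTriples]) (by simp [fccSlotTriples]),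
      inner_barlowPos_eq_half (by simp [fccSlotTriples]) (by simp [fccSlotTriples]) (by simp [fccSlotTriples]),
      inner_barlowPos_eq_half (by simp [fccSlotTriples]) (by simp [fccSlotTriples]) (by simp [fccSlotTriples])⟩
  -- (0,-1,0): t = (1,-1,0), a = (0,-1,1)
  · exact ⟨barlowPos 1 (Real.sqrt (2 / 3)) constHagg 1 (-1) 0, barlowPos 1 (Real.sqrt (2 / 3)) constHagg 0 (-1) 1,
      barlowPos_mem_fccSlots (by simp [fccSlotTriples] : ((1:ℤ), (-1:ℤ), (0:ℤ)) ∈ fccSlotTriples), by rw [barlowPos_apply_two]; simp,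
      barlowPos_mem_fccSlots (by simp [fccSlotTriples] : ((0:ℤ), (-1:ℤ), (1:ℤ)) ∈ fccSlotTriples), by rw [barlowPos_apply_two]; simp,
      inner_barlowPos_eq_half (by simp [fccSlotTriples]) (by simp [fccSlotTriples]) (by simp [fccSlotTriples]),
      inner_barlowPos_eq_half (by simp [fccSlotTriples]) (by simp [fccSlotTriples]) (by simp [fccSlotTriples]),
      inner_barlowPos_eq_half (by simp [fccSlotTriples]) (by simp [fccSlotTriples]) (by simp [fccSlotTriples])⟩
  -- (0,0,-1): t = (1,0,-1), a = (0,1,-1)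
  · exact ⟨barlowPos 1 (Real.sqrt (2 / 3)) constHagg 1 0 (-1), barlowPos 1 (Real.sqrt (2 / 3)) constHagg 0 1 (-1),
      barlowPos_mem_fccSlots (by simp [fccSlotTriples] : ((1:ℤ), (0:ℤ), (-1:ℤ)) ∈ fccSlotTriples), by rw [barlowPos_apply_two]; simp,
      barlowPos_mem_fccSlots (by simp [fccSlotTriples] : ((0:ℤ), (1:ℤ), (-1:ℤ)) ∈ fccSlotTriples), by rw [barlowPos_apply_two]; simp,
      inner_barlowPos_eq_half (by simp [fccSlotTriples]) (by simp [fccSlotTriples]) (by simp [fccSlotTriples]),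
      inner_barlowPos_eq_half (by simp [fccSlotTriples]) (by simp [fccSlotTriples]) (by simp [fccSlotTriples]),
      inner_barlowPos_eq_half (by simp [fccSlotTriples]) (by simp [fccSlotTriples]) (by simp [fccSlotTriples])⟩
  -- (0,-1,1): t = (1,-1,0), a = (0,-1,0)
  · exact ⟨barlowPos 1 (Real.sqrt (2 / 3)) constHagg 1 (-1) 0, barlowPos 1 (Real.sqrt (2 / 3)) constHagg 0 (-1) 0,
      barlowPos_mem_fccSlots (by simp [fccSlotTriples] : ((1:ℤ), (-1:ℤ), (0:ℤ)) ∈ fccSlotTriples), by rw [barlowPos_apply_two]; simp,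
      barlowPos_mem_fccSlots (by simp [fccSlotTriples] : ((0:ℤ), (-1:ℤ), (0:ℤ)) ∈ fccSlotTriples), by rw [barlowPos_apply_two]; simp,
      inner_barlowPos_eq_half (by simp [fccSlotTriples]) (by simp [fccSlotTriples]) (by simp [fccSlotTriples]),
      inner_barlowPos_eq_half (by simp [fccSlotTriples]) (by simp [fccSlotTriples]) (by simp [fccSlotTriples]),
      inner_barlowPos_eq_half (by simp [fccSlotTriples]) (by simp [fccSlotTriples]) (by simp [fccSlotTriples])⟩

/-! ### The mirrored upper slot is not a slot, and is far from every slot but its own -/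

/-- The square of the layer spacing. -/
private theorem sqrt23_mul_self : Real.sqrt (2 / 3) * Real.sqrt (2 / 3) = 2 / 3 := Real.mul_self_sqrt (by norm_num)

/-- **The mirror of an upper slot is no slot**: `⟪t, M t⟫ = −1/3` is not a slot angle. -/
theorem basalMirror_not_mem_fccSlots {t : EuclideanSpace ℝ (Fin 3)} (ht : t ∈ fccSlots) (ht2 : t 2 = Real.sqrt (2 / 3)) :
    basalMirror t ∉ fccSlots := by
  intro hM
  have hval : ⟪t, basalMirror t⟫_ℝ = -(1 / 3) := by
    rw [hStar_inner_mirror_right, real_inner_self_eq_norm_sq, norm_eq_one_of_mem_fccSlots ht, ht2]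
    nlinarith [sqrt23_mul_self]
  rcases inner_slots_mem ht hM with h | h | h | h | h <;> rw [hval] at h <;> norm_num at h

/-- **Only the slot `t` itself sees `M t` at inner product `−1/3`.** -/
theorem eq_of_inner_basalMirror_eq {w t : EuclideanSpace ℝ (Fin 3)} (hw : w ∈ fccSlots) (ht : t ∈ fccSlots)
    (ht2 : t 2 = Real.sqrt (2 / 3)) (h : ⟪w, basalMirror t⟫_ℝ = -(1 / 3)) : w = t := by
  rw [hStar_inner_mirror_right, ht2] at h
  have hs := sqrt23_mul_self
  have hspos : 0 < Real.sqrt (2 / 3) := Real.sqrt_pos.2 (by norm_num)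
  rcases slot_apply_two_cases hw with h2 | h2 | h2
  · -- in-plane: `⟪w, t⟫ = −1/3`, not a slot angle
    rw [h2] at h
    rcases inner_slots_mem hw ht with h' | h' | h' | h' | h' <;> rw [h'] at h <;> norm_num at h
  · -- upper: `⟪w, t⟫ = 1`, so `w = t`
    rw [h2] at h
    have hwt : ⟪w, t⟫_ℝ = 1 := by nlinarith
    have h0 : ‖w - t‖ ^ 2 = 0 := by
      rw [norm_sub_sq_real, norm_eq_one_of_mem_fccSlots hw, norm_eq_one_of_mem_fccSlots ht, hwt]; norm_num
    rw [sq_eq_zero_iff, norm_eq_zero, sub_eq_zero] at h0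
    exact h0
  · -- lower: `⟪w, t⟫ = −5/3`, impossible
    rw [h2] at h
    have hwt : ⟪w, t⟫_ℝ = -(5 / 3) := by nlinarith
    rcases inner_slots_mem hw ht with h' | h' | h' | h' | h' <;> rw [h'] at hwt <;> norm_num at hwt

/-! ### The single-dozen lemma -/

/-- A close-packed dozen at the origin, with the `+ 0` of `IsClosePackedDozenAt` removed. -/
private theorem dozen_images {D : Finset (EuclideanSpace ℝ (Fin 3))} (hD : IsClosePackedDozenAt 0 D) :
    ∃ B : EuclideanSpace ℝ (Fin 3) →ₗᵢ[ℝ] EuclideanSpace ℝ (Fin 3),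
      (↑D : Set (EuclideanSpace ℝ (Fin 3))) = B '' (↑fccKissingPattern : Set (EuclideanSpace ℝ (Fin 3))) ∨
        (↑D : Set (EuclideanSpace ℝ (Fin 3))) = B '' (↑hcpKissingPattern : Set (EuclideanSpace ℝ (Fin 3))) := by
  obtain ⟨B, hB⟩ := hD
  refine ⟨B, ?_⟩
  simpa only [add_zero] using hB

/-- **THE EQUATORIAL CLOSED STAR LIES IN ONE CLOSE-PACKED DOZEN**: for an in-plane slot `u₀`, `SingleDozen 0 hcpSlots (hStar u₀)`. -/
theorem singleDozen_hStar {u₀ : EuclideanSpace ℝ (Fin 3)} (hu₀ : u₀ ∈ fccSlots) (hu₀2 : u₀ 2 = 0) :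
    SingleDozen 0 hcpSlots (hStar u₀) := by
  classical
  intro D hD hsub
  have hs := sqrt23_mul_self
  have hspos : 0 < Real.sqrt (2 / 3) := Real.sqrt_pos.2 (by norm_num)
  -- the star: `b = −u₀`, the triangle `b, a, t`, and the mirror `M t`
  set b : EuclideanSpace ℝ (Fin 3) := -u₀ with hb
  have hbS : b ∈ fccSlots := neg_mem_fccSlots hu₀
  have hb2 : b 2 = 0 := by rw [hb, PiLp.neg_apply, hu₀2, neg_zero]
  obtain ⟨t, a, htS, ht2, haS, ha2, hbt, hba, hat⟩ := exists_triangle_of_inPlane hbS hb2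
  have ht0 : 0 ≤ t 2 := by rw [ht2]; exact hspos.le
  have hstar : ∀ {s : EuclideanSpace ℝ (Fin 3)}, s ∈ hcpSlots → 0 < ⟪s, b⟫_ℝ → s ∈ D := fun {s} hs hpos =>
    hsub (mem_filter.2 ⟨hs, hpos⟩)
  have hbD : b ∈ D := hstar (mem_hcpSlots_of_inPlane hbS hb2)
    (by rw [real_inner_self_eq_norm_sq, norm_eq_one_of_mem_fccSlots hbS]; norm_num)
  have haD : a ∈ D := hstar (mem_hcpSlots_of_inPlane haS ha2) (by rw [real_inner_comm]; rw [hba]; norm_num)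
  have htD : t ∈ D := hstar (mem_hcpSlots_of_upper htS ht0) (by rw [real_inner_comm]; rw [hbt]; norm_num)
  have hMtD : basalMirror t ∈ D := hstar (basalMirror_mem_hcpSlots_of_upper htS ht0)
    (by rw [inner_basalMirror_of_inPlane t hb2, real_inner_comm, hbt]; norm_num)
  have hMt : basalMirror t ∉ fccSlots := basalMirror_not_mem_fccSlots htS ht2
  have hind : LinearIndependent ℝ ![b, a, t] := linearIndependent_of_pairwise_half hbS haS htS hba hbt hat
  -- the two pattern cases
  set A₀ : EuclideanSpace ℝ (Fin 3) ≃ₗᵢ[ℝ] EuclideanSpace ℝ (Fin 3) := LinearIsometryEquiv.refl ℝ _ with hA₀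
  have hAslot : ∀ {w : EuclideanSpace ℝ (Fin 3)}, w ∈ fccSlots → w ∈ A₀ '' (↑fccSlots : Set (EuclideanSpace ℝ (Fin 3))) :=
    fun {w} hw => ⟨w, hw, rfl⟩
  obtain ⟨B, hDf | hDh⟩ := dozen_images hD
  · -- cuboctahedral: `D = fccSlots`, but `M t ∈ D` is no slot
    exfalso
    have hmem : ∀ {w}, w ∈ D → w ∈ B '' (↑fccKissingPattern : Set (EuclideanSpace ℝ (Fin 3))) := fun {w} hw => by
      rw [← hDf]; exact hw
    have hEq := fccDozen_eq_slots_of_three_independent A₀ B (hmem hbD) (hmem haD) (hmem htD) (hAslot hbS) (hAslot haS) (hAslot htS) hind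
    have : basalMirror t ∈ A₀ '' (↑fccSlots : Set (EuclideanSpace ℝ (Fin 3))) := by rw [← hEq]; exact hmem hMtD
    obtain ⟨w, hw, hwe⟩ := this
    exact hMt (by rw [← hwe]; exact hw)
  · -- anticuboctahedral: a twin dozen across `n`; `M t` pins `n = −e₃`
    have hmem : ∀ {w}, w ∈ D → w ∈ B '' (↑hcpKissingPattern : Set (EuclideanSpace ℝ (Fin 3))) := fun {w} hw => by
      rw [← hDh]; exact hw
    obtain ⟨n, hn1, hmenu, hEq⟩ :=
      hcpDozen_twin_of_three_independent A₀ B (hmem hbD) (hmem haD) (hmem htD) (hAslot hbS) (hAslot haS) (hAslot htS) hind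
    have hA₀w : ∀ w : EuclideanSpace ℝ (Fin 3), A₀ w = w := fun w => rfl
    simp only [hA₀w] at hmenu hEq
    -- `M t ∈ D` is a mirror image `w − 2⟪w,n⟫ n` of a negative slot `w`
    have hMt' : basalMirror t ∈ (fun w => w) '' {w | w ∈ fccSlots ∧ ⟪w, n⟫_ℝ ≤ 0} ∪
        (fun w => w - (2 * ⟪w, n⟫_ℝ) • n) '' {w | w ∈ fccSlots ∧ ⟪w, n⟫_ℝ < 0} := by rw [← hEq]; exact hmem hMtD
    rcases hMt' with ⟨w, ⟨hw, -⟩, hwe⟩ | ⟨w, ⟨hw, hwn⟩, hwe⟩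
    · exact absurd (by rw [← hwe]; exact hw) hMt
    have hwn' : ⟪w, n⟫_ℝ = -Real.sqrt (2 / 3) := by
      rcases hmenu w hw with h | h | h
      · rw [h] at hwn; exact absurd hwn (lt_irrefl 0)
      · rw [h] at hwn; exact absurd hwn (not_lt.2 hspos.le)
      · exact h
    -- `⟪w, M t⟫ = −1/3`, hence `w = t`
    have hnn : ⟪n, n⟫_ℝ = 1 := by rw [real_inner_self_eq_norm_sq, hn1, one_pow]
    have hwMt : ⟪w, basalMirror t⟫_ℝ = -(1 / 3) := by
      rw [← hwe, inner_sub_right, inner_smul_right, real_inner_self_eq_norm_sq, norm_eq_one_of_mem_fccSlots hw, hwn']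
      nlinarith [hs]
    have hwt : w = t := eq_of_inner_basalMirror_eq hw htS ht2 hwMt
    subst hwt
    -- hence `n = −e₃`
    have hn : n = -EuclideanSpace.single (2 : Fin 3) (1 : ℝ) := by
      beta_reduce at hwe
      rw [basalMirror_eq_sub_smul w, hwn', ht2] at hwe
      -- `hwe : w − (2·(−c)) • n = w − (2c) • e₃`
      have hA : (2 * -Real.sqrt (2 / 3)) • n = (2 * Real.sqrt (2 / 3)) • EuclideanSpace.single (2 : Fin 3) (1 : ℝ) :=
        sub_right_injective hwe
      rw [mul_neg, neg_smul, neg_eq_iff_eq_neg, ← smul_neg] at hA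
      have hc : (2 * Real.sqrt (2 / 3)) ≠ 0 := by positivity
      exact smul_right_injective _ hc hA
    subst hn
    -- with `n = −e₃` the twin dozen is `hcpSlots`
    have hi : ∀ v : EuclideanSpace ℝ (Fin 3), ⟪v, -EuclideanSpace.single (2 : Fin 3) (1 : ℝ)⟫_ℝ = -v 2 := fun v => by
      rw [inner_neg_right, inner_single_two_one]
    have htw : ∀ v : EuclideanSpace ℝ (Fin 3),
        v - (2 * ⟪v, -EuclideanSpace.single (2 : Fin 3) (1 : ℝ)⟫_ℝ) • (-EuclideanSpace.single (2 : Fin 3) (1 : ℝ)) = basalMirror v := by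
      intro v
      rw [hi, basalMirror_eq_sub_smul, mul_neg, neg_smul, smul_neg, neg_neg]
    have hDset : ∀ s : EuclideanSpace ℝ (Fin 3), s ∈ D ↔
        s ∈ (fun w => w) '' {w | w ∈ fccSlots ∧ ⟪w, -EuclideanSpace.single (2 : Fin 3) (1 : ℝ)⟫_ℝ ≤ 0} ∪
          (fun w => w - (2 * ⟪w, -EuclideanSpace.single (2 : Fin 3) (1 : ℝ)⟫_ℝ) • (-EuclideanSpace.single (2 : Fin 3) (1 : ℝ))) ''
            {w | w ∈ fccSlots ∧ ⟪w, -EuclideanSpace.single (2 : Fin 3) (1 : ℝ)⟫_ℝ < 0} := by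
      intro s; rw [← hEq, ← hDh, Finset.mem_coe]
    apply Finset.Subset.antisymm
    · intro s hsD
      rcases (hDset s).1 hsD with ⟨v, ⟨hv, hv0⟩, rfl⟩ | ⟨v, ⟨hv, hv0⟩, rfl⟩
      · rw [hi] at hv0
        exact mem_hcpSlots_of_upper hv (by linarith)
      · rw [hi] at hv0
        show v - _ ∈ hcpSlots
        rw [htw]
        exact basalMirror_mem_hcpSlots_of_upper hv (by linarith)
    · intro s hsH
      rcases mem_hcpSlots.1 hsH with ⟨hs', hs0⟩ | ⟨v, ⟨hv, hv0⟩, rfl⟩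
      · exact (hDset s).2 (Or.inl ⟨s, ⟨hs', by rw [hi]; linarith⟩, rfl⟩)
      · rcases hv0.lt_or_eq with hlt | heq
        · exact (hDset _).2 (Or.inr ⟨v, ⟨hv, by rw [hi]; linarith⟩, htw v⟩)
        · rw [basalMirror_of_inPlane heq.symm]
          exact (hDset v).2 (Or.inl ⟨v, ⟨hv, by rw [hi]; linarith⟩, rfl⟩)

/-- **E1h reduces to the `ExactOnly` rows**: the single-dozen half of `HStarModel` is the theorem above. -/
theorem hStarModel_of_exactOnly (h : ∀ u₀ ∈ fccSlots, u₀ 2 = 0 → ExactOnly 0 (hStar u₀)) : HStarModel :=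
  fun u₀ hu₀ hu₀2 => ⟨h u₀ hu₀ hu₀2, singleDozen_hStar hu₀ hu₀2⟩

end Summit.Ventures.Crystal3D.Theorems

end
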